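import Summits.ABC.IUTFork.LDHGenuine
import Literature.IUT.LogVolume.GenuineLogThetaExactVolumeInput
import Literature.IUT.LogVolume.GenuineLogThetaSlotChoice
import HarnessLib

/-!
# The fork at [IUTchIII] Corollary 3.12, L-DH level: Dupuy–Hilado's (1.1) for the datum OF a genuine input is an
# explicit inequality in finitely many content integers; a place-combinatorial sufficient condition

Record/proof-only file (D-0012) of the abc-iut cell (Cor. 3.12 crew, L-DH lane, seat abc-iut-c312-3; item
«XXVIIc-DH» of `HOME/skel/FORK-INDEX.md` row 2, DH-GLOBAL column «OPEN = `Cor312DH (ofInput I)` / `I.Cor312Of` …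
converse ARGUED»). TAKES NO SIDE on [IUTchIII] Cor. 3.12. Dupuy–Hilado, arXiv:2004.13228 (pre-split text) §1 (1.1),
Def. 3.6.3, §4.7, §4.9–4.12; [IUTchIII] Cor. 3.12 (kurims p. 173–174); [IUTchIV] Thm. 1.10 Step (v) (kurims p. 27–28).

Read through abc-iut-S2's bridge `LDHGenuine` (`negLogThetaDH_ofInput`, `cor312DH_ofInput_iff`), the Literature-level
results of `GenuineLogThetaExactVolumeInput` / `GenuineLogThetaSlotChoice` give, for the Dupuy–Hilado datum
`DHData.ofInput I` of EVERY genuine Θ-volume input `I` (sharp (Ind3), (Ind1) = all slot permutations, (Ind2) =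
`Aut_{ℚ_p}(V : log_p(R_I^×))`, hull = `(R_I)^∼`-span, Mochizuki's shell normalisation — which the numbers do not see):

* **`negLogThetaDH_ofInput_eq_of_content`** — `ln ν̄_𝕃(hull(U_Θ))` of the datum is the explicit affine function
  `Σ_{p∈T(I)} (1/ℓ⋇)·Σ_i Σ_{v⃗} (−m(p,i,v⃗)·log p + log μ̄(hull(log_p(R_{v⃗}^×))))·Π_b Pr(v_b)` of ANY content family `m`
  (contents of the slot unions `⋃_a ι_a(t_{Θ,i,v_a})·(R_I)^∼` w.r.t. `log_p(R_{v⃗}^×)`; such a family exists,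
  `ThetaVolumeInput.exists_contentFamily`);
* **`cor312DH_ofInput_iff_of_content`** — Dupuy–Hilado's (1.1) for the datum ⟺ `−deĝ̲(P_q) ≤` that sum: at the
  genuine datum the disputed inequality IS an explicit inequality between the `q`-pilot degree and finitely many
  lattice contents — the two-sided form («no slack either way») asked for in `HOME/skel/FORK-REAL-MODEL.md` §4;
  its necessary direction in degrees is `LDHGenuine.gap_le_of_cor312DH_input` ([IUTchIV] Thm. 1.10), the window
  of each content is abc-iut-w5-d082's `TensorPacketContentBounds`;
* **`cor312DH_ofInput_of_slotChoice`** — the place-combinatorial SUFFICIENT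
  condition: if for some slot selector `s` the `q`-pilot degree dominates the slot-selected Θ-mass
  (`−deĝ̲(P_q) ≤ −Σ_{p∈T(I)} (1/ℓ⋇)·Σ_i Σ_{v⃗} P_{Θ,i}(v_s)·ln N(v_s)/n_{v_s}·Π Pr`, pilot data and places only),
  then (1.1) holds for the datum (Cor. 3.12 for the input: `ThetaVolumeInput.cor312Of_of_slotChoice`) — the DH-GLOBAL genuine-input form of «readings
  HOLD at mixed summands» (skeleton XXVIc; abc-iut-w4-d096 `ForkPacketCompetition`), complementing the FALSE side
  (abc-iut-w5-d157 `LDHPerPrimeReading`, `LDHSyntheticCor312Failure`).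

[cite: DupuyHilado2025, §1 (1.1), Def. 3.6.3, §4.12] [cite: Mochizuki2012, IUTchIII Cor. 3.12 p. 173–174]
[cite: Mochizuki2012, IUTchIV Thm. 1.10 Step (v) p. 27–28] [claim: Mochizuki2012, status: disputed]
HONEST SCOPE: `Cor312DH`/`Cor312Of` remain HYPOTHESIS-shaped; the sufficient condition is discharged for no input
here; nothing about print's Cor. 3.12 is asserted. PROOF-ONLY file: no definitions, no named `Prop` facts.
-/

noncomputable section

namespace Summit.ABC.IUTFork

namespace DHData

open Literature.IUT.LogVolume NumberField IsDedekindDomain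
open scoped Pointwise

variable {F₀ : Type} [Field F₀] [NumberField F₀] {K : Type} [Field K] [NumberField K] [Algebra F₀ K]
variable (I : ThetaVolumeInput F₀ K)

/-- **`ln ν̄_𝕃(hull(U_Θ))` of the datum of a genuine input is an explicit affine function of the contents**: for any
content family `m(p,i,v⃗)`,
`(ofInput I).negLogThetaDH = Σ_{p∈T(I)} (1/ℓ⋇)·Σ_i Σ_{v⃗} (−m(p,i,v⃗)·log p + log μ̄(hull(log_p(R_{v⃗}^×))))·Π_b Pr(v_b)`.
[cite: DupuyHilado2025, §1 (1.1), Def. 3.6.3, §4.12] -/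
theorem negLogThetaDH_ofInput_eq_of_content
    (m : (p : ℕ) → (i : Fin I.lstar) → (Fin ((i : ℕ) + 1 + 1) → placesOver F₀ p) → ℤ)
    (hm : ∀ (p : ℕ) [hp : Fact p.Prime], p ∈ I.supportPrimes →
      ∀ (i : Fin I.lstar) (e : Fin ((i : ℕ) + 1 + 1) → placesOver F₀ p),
      (⋃ a : Fin ((i : ℕ) + 1 + 1), iota p (fun b => (I.σ.localFieldFamily p hp.out).k (e b)) a
            (I.tΘ p hp.out i (e a) : (I.σ.localFieldFamily p hp.out).k (e a)) •
          (normalizedPacket p (fun b => (I.σ.localFieldFamily p hp.out).k (e b)) :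
            Set (PacketAlgebra p (fun b => (I.σ.localFieldFamily p hp.out).k (e b))))) ⊆
        ((p : ℚ_[p]) ^ m p i e) • (logPacket p (fun b => (I.σ.localFieldFamily p hp.out).k (e b)) :
            Set (PacketAlgebra p (fun b => (I.σ.localFieldFamily p hp.out).k (e b)))) ∧
      ¬ (⋃ a : Fin ((i : ℕ) + 1 + 1), iota p (fun b => (I.σ.localFieldFamily p hp.out).k (e b)) a
            (I.tΘ p hp.out i (e a) : (I.σ.localFieldFamily p hp.out).k (e a)) •
          (normalizedPacket p (fun b => (I.σ.localFieldFamily p hp.out).k (e b)) :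
            Set (PacketAlgebra p (fun b => (I.σ.localFieldFamily p hp.out).k (e b))))) ⊆
        ((p : ℚ_[p]) ^ (m p i e + 1)) • (logPacket p (fun b => (I.σ.localFieldFamily p hp.out).k (e b)) :
            Set (PacketAlgebra p (fun b => (I.σ.localFieldFamily p hp.out).k (e b))))) :
    (ofInput I).negLogThetaDH = ∑ p ∈ I.supportPrimes,
      (1 / (I.lstar : ℝ)) * ∑ i : Fin I.lstar, ∑ e : Fin ((i : ℕ) + 1 + 1) → placesOver F₀ p,
        (if hp : p.Prime then
          haveI : Fact p.Prime := ⟨hp⟩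
          (-(m p i e * Real.log p) + packetLogμ p (fun b => (I.σ.localFieldFamily p hp).k (e b))
            (packetHull p (fun b => (I.σ.localFieldFamily p hp).k (e b))
              (logPacket p (fun b => (I.σ.localFieldFamily p hp).k (e b)) :
                Set (PacketAlgebra p (fun b => (I.σ.localFieldFamily p hp).k (e b)))))) *
            ∏ b, weight F₀ (e b).1
          else 0) := by
  rw [negLogThetaDH_ofInput]
  exact I.negLogThetaNonarch_eq_of_content m hm

/-- **Dupuy–Hilado's (1.1) for the datum of a genuine input ⟺ the explicit content inequality**
`−deĝ̲(P_q) ≤ Σ_{p∈T(I)} (1/ℓ⋇)·Σ_i Σ_{v⃗} (−m(p,i,v⃗)·log p + log μ̄(hull(log_p(R_{v⃗}^×))))·Π_b Pr(v_b)`, for any content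
family `m`. HYPOTHESIS-shaped on both sides; nothing asserted. [claim: Mochizuki2012, status: disputed]
[cite: DupuyHilado2025, §1 (1.1)] -/
theorem cor312DH_ofInput_iff_of_content
    (m : (p : ℕ) → (i : Fin I.lstar) → (Fin ((i : ℕ) + 1 + 1) → placesOver F₀ p) → ℤ)
    (hm : ∀ (p : ℕ) [hp : Fact p.Prime], p ∈ I.supportPrimes →
      ∀ (i : Fin I.lstar) (e : Fin ((i : ℕ) + 1 + 1) → placesOver F₀ p),
      (⋃ a : Fin ((i : ℕ) + 1 + 1), iota p (fun b => (I.σ.localFieldFamily p hp.out).k (e b)) a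
            (I.tΘ p hp.out i (e a) : (I.σ.localFieldFamily p hp.out).k (e a)) •
          (normalizedPacket p (fun b => (I.σ.localFieldFamily p hp.out).k (e b)) :
            Set (PacketAlgebra p (fun b => (I.σ.localFieldFamily p hp.out).k (e b))))) ⊆
        ((p : ℚ_[p]) ^ m p i e) • (logPacket p (fun b => (I.σ.localFieldFamily p hp.out).k (e b)) :
            Set (PacketAlgebra p (fun b => (I.σ.localFieldFamily p hp.out).k (e b)))) ∧
      ¬ (⋃ a : Fin ((i : ℕ) + 1 + 1), iota p (fun b => (I.σ.localFieldFamily p hp.out).k (e b)) a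
            (I.tΘ p hp.out i (e a) : (I.σ.localFieldFamily p hp.out).k (e a)) •
          (normalizedPacket p (fun b => (I.σ.localFieldFamily p hp.out).k (e b)) :
            Set (PacketAlgebra p (fun b => (I.σ.localFieldFamily p hp.out).k (e b))))) ⊆
        ((p : ℚ_[p]) ^ (m p i e + 1)) • (logPacket p (fun b => (I.σ.localFieldFamily p hp.out).k (e b)) :
            Set (PacketAlgebra p (fun b => (I.σ.localFieldFamily p hp.out).k (e b))))) :
    (ofInput I).Cor312DH ↔ -FinDivisor.ndeg F₀ I.X.qPilot ≤ ∑ p ∈ I.supportPrimes,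
      (1 / (I.lstar : ℝ)) * ∑ i : Fin I.lstar, ∑ e : Fin ((i : ℕ) + 1 + 1) → placesOver F₀ p,
        (if hp : p.Prime then
          haveI : Fact p.Prime := ⟨hp⟩
          (-(m p i e * Real.log p) + packetLogμ p (fun b => (I.σ.localFieldFamily p hp).k (e b))
            (packetHull p (fun b => (I.σ.localFieldFamily p hp).k (e b))
              (logPacket p (fun b => (I.σ.localFieldFamily p hp).k (e b)) :
                Set (PacketAlgebra p (fun b => (I.σ.localFieldFamily p hp).k (e b)))))) *
            ∏ b, weight F₀ (e b).1
          else 0) := by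
  rw [cor312DH_ofInput_iff]
  exact I.cor312NonarchOf_iff_of_content m hm

/-- **The place-combinatorial sufficient condition, DH form**: if for some slot selector `s` the `q`-pilot degree
dominates the slot-selected Θ-mass, `−deĝ̲(P_q) ≤ −Σ_{p∈T(I)} (1/ℓ⋇)·Σ_i Σ_{v⃗} P_{Θ,i}(v_s)·ln N(v_s)/n_{v_s}·Π Pr`,
then Dupuy–Hilado's (1.1) holds for the datum of `I`. The hypothesis (pilot data and places only) is discharged
for no input here. [claim: Mochizuki2012, status: disputed] [cite: DupuyHilado2025, §1 (1.1), §4.7, §4.12] -/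
theorem cor312DH_ofInput_of_slotChoice
    (s : (p : ℕ) → (i : Fin I.lstar) → (Fin ((i : ℕ) + 1 + 1) → placesOver F₀ p) → Fin ((i : ℕ) + 1 + 1))
    (h : -FinDivisor.ndeg F₀ I.X.qPilot ≤
      ∑ p ∈ I.supportPrimes, (1 / (I.lstar : ℝ)) * ∑ i : Fin I.lstar, ∑ e : Fin ((i : ℕ) + 1 + 1) → placesOver F₀ p,
        (-(I.X.thetaPilot i (e (s p i e)).1) * logNorm F₀ (e (s p i e)).1 / localDegree F₀ (e (s p i e)).1) *
          ∏ b, weight F₀ (e b).1) :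
    (ofInput I).Cor312DH :=
  (cor312DH_ofInput_iff I).mpr (I.cor312NonarchOf_of_slotChoice s h)

/-- **The slot-choice lower bound for `ln ν̄_𝕃(hull(U_Θ))` of the datum**, in pilot data: for every slot selector,
`−Σ_{p∈T(I)} (1/ℓ⋇)·Σ_i Σ_{v⃗} P_{Θ,i}(v_s)·ln N(v_s)/n_{v_s}·Π Pr ≤ (ofInput I).negLogThetaDH` (at the last-slot
selector: the free inequality `DHData.free_inequality`). [cite: DupuyHilado2025, §4.11–4.12]
[cite: Mochizuki2012, IUTchIV Thm. 1.10 Step (v) p. 27–28] -/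
theorem negLogThetaDH_ofInput_ge_slotChoice
    (s : (p : ℕ) → (i : Fin I.lstar) → (Fin ((i : ℕ) + 1 + 1) → placesOver F₀ p) → Fin ((i : ℕ) + 1 + 1)) :
    ∑ p ∈ I.supportPrimes, (1 / (I.lstar : ℝ)) * ∑ i : Fin I.lstar, ∑ e : Fin ((i : ℕ) + 1 + 1) → placesOver F₀ p,
        (-(I.X.thetaPilot i (e (s p i e)).1) * logNorm F₀ (e (s p i e)).1 / localDegree F₀ (e (s p i e)).1) *
          ∏ b, weight F₀ (e b).1 ≤
      (ofInput I).negLogThetaDH := by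
  rw [negLogThetaDH_ofInput]
  exact I.negLogThetaNonarch_ge_slotChoice s

end DHData

end Summit.ABC.IUTFork

end
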